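import Literature.Geometry.Riemannian.MetricFlow
import Mathlib.Probability.Kernel.Composition.IntegralCompProd
import Mathlib.Probability.Kernel.Composition.MeasureComp
import HarnessLib

/-!
# Heat flows on a metric flow: measurability of the conjugate heat kernels, the reproduction
# formula as a composition of Markov kernels, and existence/uniqueness of (conjugate) heat flows
# (Bamler 2023, §3.2)

R. Bamler, *Compactness theory of the space of super Ricci flows*, Invent. Math. 233 (2023), §3.1,
Def. 3.2 and §3.2. After Def. 3.2: "by Properties (5), (6) the integrand [`y ↦ ν_{y;t₁}(S)` of the
reproduction formula] is continuous if `t₁ < t₂` and measurable if `t₁ = t₂`." §3.2, Proposition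
(existence and uniqueness of heat flows): "Assume that `t₀ := inf I' ∈ I'` and consider a bounded
measurable function `ũ : 𝒳_{t₀} → ℝ`. Then there is a unique heat flow `(u_t)_{t ∈ I'}` with
`u_{t₀} = ũ`. Proof. Define `u_t(x) := ∫_{𝒳_{t₀}} ũ dν_{x;t₀}`. Then (the heat flow identity)
follows using the reproduction formula." and dually (conjugate heat flows): "Assume that
`t₀ := sup I' ∈ I'` and consider a probability measure `μ̃ ∈ 𝒫(𝒳_{t₀})`. Then there is a unique
conjugate heat flow `(μ_t)_{t ∈ I'}` with `μ_{t₀} = μ̃`. Proof. Define `μ_t := ∫_{𝒳_{t₀}} ν_{x;t} dμ̃(x)`."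

Over `MetricFlow.lean` (the structure `MetricFlow I`, `condKernel`, `IsHeatFlow`,
`IsConjugateHeatFlow`) this file PROVES, with Mathlib's Markov kernels (`ProbabilityTheory.Kernel`):

* `MetricFlow.measurable_condKernel_apply`, `MetricFlow.measurable_condKernel` — for `t₁ ≤ t₂`
  in `I` and measurable `S ⊆ 𝒳_{t₁}`, `y ↦ ν_{y;t₁}(S)` is measurable on `𝒳_{t₂}` (from item (6) of
  Def. 3.2 with `T = 0`, `u = 𝟙_S`, resp. item (5) if `t₁ = t₂`), i.e. `y ↦ ν_{y;t₁}` is a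
  measurable map into measures;
* `MetricFlow.kernel` — the conjugate heat kernels `𝒳_{t₂} → 𝒫(𝒳_{t₁})`, `t₁ ≤ t₂`, as a Markov
  kernel; `MetricFlow.condKernel_eq_comp` — **the reproduction formula (7) as the composition**
  `ν_{x;t₁} = kernel ∘ₘ ν_{x;t₂}`; `MetricFlow.integral_integral_condKernel` — its integrated form
  `∫_{𝒳_{t₂}} (∫_{𝒳_{t₁}} f dν_{y;t₁}) dν_{x;t₂}(y) = ∫_{𝒳_{t₁}} f dν_{x;t₁}` for bounded measurable `f`;
* `MetricFlow.heatFlowOf`, `MetricFlow.isHeatFlow_heatFlowOf`, `MetricFlow.heatFlowOf_self`,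
  `MetricFlow.IsHeatFlow.eq_heatFlowOf` — **existence and uniqueness of the heat flow with bounded
  measurable initial data at `t₀ = min I'`**;
* `MetricFlow.conjugateHeatFlowOf`, `MetricFlow.isConjugateHeatFlow_conjugateHeatFlowOf`,
  `MetricFlow.conjugateHeatFlowOf_self`, `MetricFlow.IsConjugateHeatFlow.eq_conjugateHeatFlowOf` —
  **existence and uniqueness of the conjugate heat flow with final data at `t₀ = max I'`**.

Everything is proved; no definitions of new notions beyond the two flows named in the source, no
named facts. What is NOT here: the maximum principle and the gradient estimates for heat flows
(the two Propositions following in §3.2), `H`-concentration (Def. 3.30).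

## References

* R. H. Bamler, *Compactness theory of the space of super Ricci flows*, Invent. Math. 233 (2023),
  1121–1277 (arXiv:2008.09298), §3.1 Def. 3.2 and the sentence after it; §3.2, Definitions (heat
  flow), (conjugate heat flow) and the two existence-and-uniqueness Propositions. [Bamler2023]
-/

noncomputable section

open Set MeasureTheory ProbabilityTheory Filter
open scoped Topology ENNReal NNReal ProbabilityTheory

namespace Literature.Geometry.Riemannian

namespace MetricFlow

universe u

variable {I : Set ℝ} (𝒳 : MetricFlow.{u} I)

/-! ### Measurability of `y ↦ ν_{y;t₁}` -/

/-- **`y ↦ ν_{y;t₁}(S)` is measurable on `𝒳_{t₂}`** for `t₁ ≤ t₂` in `I` and measurable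
`S ⊆ 𝒳_{t₁}` (Bamler 2023, after Def. 3.2: "by Properties (5), (6) the integrand is continuous if
`t₁ < t₂` and measurable if `t₁ = t₂`"): for `t₁ = t₂` it is `𝟙_S` by (5); for `t₁ < t₂`, item (6)
with `T = 0` and `u = 𝟙_S` makes `y ↦ ν_{y;t₁}(S) = ∫ 𝟙_S dν_{y;t₁}` constant or `Φ ∘ f'` with `f'`
Lipschitz, hence measurable (`Φ` is monotone). [cite: Bamler2023, §3.1, Def. 3.2 (metric flow)] -/
theorem measurable_condKernel_apply {t₁ t₂ : I} (h : (t₁ : ℝ) ≤ t₂) {S : Set (𝒳.Slice t₁)}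
    (hS : MeasurableSet S) : Measurable fun y : 𝒳.Slice t₂ ↦ 𝒳.condKernel y t₁ S := by
  rcases h.eq_or_lt with heq | hlt
  · -- `t₁ = t₂`: `ν_{y;t₁} = δ_y`
    have : t₁ = t₂ := Subtype.ext heq
    subst this
    have hd : (fun y : 𝒳.Slice t₁ ↦ 𝒳.condKernel y t₁ S) = fun y ↦ Measure.dirac y S := by
      funext y; rw [𝒳.condKernel_self]
    rw [hd]
    simp_rw [Measure.dirac_apply' _ hS]
    exact (measurable_one.indicator hS)
  · -- `t₁ < t₂`: item (6) with `T = 0`, `u = 𝟙_S`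
    set u : 𝒳.Slice t₁ → ℝ := S.indicator 1 with hu
    have hum : Measurable u := measurable_one.indicator hS
    have hu01 : ∀ y, u y ∈ Icc (0 : ℝ) 1 := by
      intro y
      by_cases hy : y ∈ S <;> simp [hu, hy]
    have key := 𝒳.gradient_property hlt 0 le_rfl u hum hu01 (fun h0 ↦ (lt_irrefl _ h0).elim)
    -- `∫ 𝟙_S dν_{y;t₁} = ν_{y;t₁}(S)` (a probability measure)
    have hint : ∀ y : 𝒳.Slice t₂, ∫ z, u z ∂(𝒳.condKernel y t₁) = (𝒳.condKernel y t₁).real S :=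
      fun y ↦ integral_indicator_one hS
    have hreal : Measurable fun y : 𝒳.Slice t₂ ↦ (𝒳.condKernel y t₁).real S := by
      rcases key with ⟨c, hc⟩ | ⟨f', hf', hf'eq⟩
      · have : (fun y : 𝒳.Slice t₂ ↦ (𝒳.condKernel y t₁).real S) = fun _ ↦ c := by
          funext y; rw [← hint y, hc y]
        rw [this]
        exact measurable_const
      · have : (fun y : 𝒳.Slice t₂ ↦ (𝒳.condKernel y t₁).real S) = fun y ↦ Phi (f' y) := by
          funext y; rw [← hint y, hf'eq y]
        rw [this]
        exact Phi_mono.measurable.comp hf'.continuous.measurable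
    have hfin : ∀ y : 𝒳.Slice t₂, 𝒳.condKernel y t₁ S = ENNReal.ofReal ((𝒳.condKernel y t₁).real S) := by
      intro y
      haveI := 𝒳.isProbabilityMeasure_condKernel y hlt.le
      rw [measureReal_def, ENNReal.ofReal_toReal (measure_ne_top _ S)]
    simp_rw [hfin]
    exact hreal.ennreal_ofReal

/-- **`y ↦ ν_{y;t₁}` is a measurable map `𝒳_{t₂} → 𝒫(𝒳_{t₁})`** for `t₁ ≤ t₂` in `I`
(measurability on measurable sets suffices, `Measure.measurable_of_measurable_coe`).
[cite: Bamler2023, §3.1, Def. 3.2 (metric flow)] -/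
theorem measurable_condKernel {t₁ t₂ : I} (h : (t₁ : ℝ) ≤ t₂) :
    Measurable fun y : 𝒳.Slice t₂ ↦ 𝒳.condKernel y t₁ :=
  Measure.measurable_of_measurable_coe _ fun _ hS ↦ 𝒳.measurable_condKernel_apply h hS

/-! ### The conjugate heat kernels as a Markov kernel; the reproduction formula as a composition -/

/-- **The conjugate heat kernels as a Markov kernel** `𝒳_{t₂} ⇝ 𝒳_{t₁}`, `t₁ ≤ t₂` in `I`
(items (4), (6) of Def. 3.2: probability measures, measurable in the base point).
[cite: Bamler2023, §3.1, Def. 3.2 (metric flow)] -/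
def kernel {t₁ t₂ : I} (h : (t₁ : ℝ) ≤ t₂) : Kernel (𝒳.Slice t₂) (𝒳.Slice t₁) where
  toFun y := 𝒳.condKernel y t₁
  measurable' := 𝒳.measurable_condKernel h

/-- The kernel evaluates to `ν_{y;t₁}`. [cite: Bamler2023, §3.1, Def. 3.2 (metric flow)] -/
@[simp] theorem kernel_apply {t₁ t₂ : I} (h : (t₁ : ℝ) ≤ t₂) (y : 𝒳.Slice t₂) :
    𝒳.kernel h y = 𝒳.condKernel y t₁ := rfl

/-- The kernel is Markov (item (4) of Def. 3.2). [cite: Bamler2023, §3.1, Def. 3.2 (metric flow)] -/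
instance isMarkovKernel_kernel {t₁ t₂ : I} (h : (t₁ : ℝ) ≤ t₂) : IsMarkovKernel (𝒳.kernel h) :=
  ⟨fun y ↦ 𝒳.isProbabilityMeasure_condKernel y h⟩

/-- **The reproduction formula (7) as a composition of a measure with a Markov kernel**:
`ν_{x;t₁} = (ν_{·;t₁}) ∘ₘ ν_{x;t₂}` for `t₁ ≤ t₂ ≤ t₃` in `I`, `x ∈ 𝒳_{t₃}`
(`Measure.bind`; "`ν_{x;t₁} = ∫_{𝒳_{t₂}} ν_{·;t₁} dν_{x;t₂}`"). [cite: Bamler2023, §3.1, Def. 3.2 (metric flow)] -/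
theorem condKernel_eq_comp {t₁ t₂ t₃ : I} (h12 : (t₁ : ℝ) ≤ t₂) (h23 : (t₂ : ℝ) ≤ t₃)
    (x : 𝒳.Slice t₃) : 𝒳.condKernel x t₁ = 𝒳.kernel h12 ∘ₘ 𝒳.condKernel x t₂ := by
  ext S hS
  rw [Measure.bind_apply hS (𝒳.kernel h12).aemeasurable]
  exact 𝒳.reproduction h12 h23 x S hS

/-- Integration against a composition `κ ∘ₘ μ`: `∫ f d(κ ∘ₘ μ) = ∫ (∫ f dκ(y)) dμ(y)` for `f`
integrable (Mathlib's `Kernel.integral_comp` through `Measure.comp_eq_comp_const_apply`). [folklore] -/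
theorem integral_comp_eq_integral_integral {α β : Type*} [MeasurableSpace α] [MeasurableSpace β]
    {μ : Measure α} [IsFiniteMeasure μ] {κ : Kernel α β} [IsMarkovKernel κ] {f : β → ℝ}
    (hf : Integrable f (κ ∘ₘ μ)) : ∫ z, f z ∂(κ ∘ₘ μ) = ∫ y, ∫ z, f z ∂κ y ∂μ := by
  rw [Measure.comp_eq_comp_const_apply] at hf ⊢
  rw [Kernel.integral_comp hf, Kernel.const_apply]

/-- A bounded measurable real function is integrable for every finite measure. [folklore] -/
theorem integrable_of_bounded_measurable {α : Type*} [MeasurableSpace α] {μ : Measure α}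
    [IsFiniteMeasure μ] {f : α → ℝ} (hf : Measurable f) {C : ℝ} (hC : ∀ x, |f x| ≤ C) :
    Integrable f μ :=
  Integrable.of_bound hf.aestronglyMeasurable C (Eventually.of_forall fun x ↦ by
    rw [Real.norm_eq_abs]; exact hC x)

/-- **The reproduction formula integrated**: for `t₁ ≤ t₂ ≤ t₃` in `I`, `x ∈ 𝒳_{t₃}` and a bounded
measurable `f : 𝒳_{t₁} → ℝ`, `∫_{𝒳_{t₂}} (∫_{𝒳_{t₁}} f dν_{y;t₁}) dν_{x;t₂}(y) = ∫_{𝒳_{t₁}} f dν_{x;t₁}`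
(the step "follows using the reproduction formula" of the existence proofs of §3.2).
[cite: Bamler2023, §3.2, Proposition (existence and uniqueness of heat flows)] -/
theorem integral_integral_condKernel {t₁ t₂ t₃ : I} (h12 : (t₁ : ℝ) ≤ t₂) (h23 : (t₂ : ℝ) ≤ t₃)
    (x : 𝒳.Slice t₃) {f : 𝒳.Slice t₁ → ℝ} (hf : Measurable f) {C : ℝ} (hC : ∀ z, |f z| ≤ C) :
    ∫ y, ∫ z, f z ∂(𝒳.condKernel y t₁) ∂(𝒳.condKernel x t₂) = ∫ z, f z ∂(𝒳.condKernel x t₁) := by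
  haveI := 𝒳.isProbabilityMeasure_condKernel x h23
  haveI := 𝒳.isProbabilityMeasure_condKernel x (h12.trans h23)
  have hfi : Integrable f (𝒳.kernel h12 ∘ₘ 𝒳.condKernel x t₂) := by
    rw [← 𝒳.condKernel_eq_comp h12 h23 x]
    exact integrable_of_bounded_measurable hf hC
  rw [𝒳.condKernel_eq_comp h12 h23 x, integral_comp_eq_integral_integral hfi]
  rfl

/-! ### Heat flows from bounded measurable initial data -/

/-- **The heat flow with initial datum `ũ` at time `t₀`**: `u_t(x) := ∫_{𝒳_{t₀}} ũ dν_{x;t₀}`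
(Bamler 2023, §3.2, proof of the Proposition on existence of heat flows), defined for all `t ∈ I`
(meaningful for `t ≥ t₀`). [cite: Bamler2023, §3.2, Proposition (existence and uniqueness of heat flows)] -/
def heatFlowOf (t₀ : I) (u₀ : 𝒳.Slice t₀ → ℝ) (t : I) (x : 𝒳.Slice t) : ℝ :=
  ∫ y, u₀ y ∂(𝒳.condKernel x t₀)

/-- Unfolding of `heatFlowOf`. [cite: Bamler2023, §3.2, Proposition (existence and uniqueness of heat flows)] -/
theorem heatFlowOf_apply (t₀ : I) (u₀ : 𝒳.Slice t₀ → ℝ) (t : I) (x : 𝒳.Slice t) :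
    𝒳.heatFlowOf t₀ u₀ t x = ∫ y, u₀ y ∂(𝒳.condKernel x t₀) := rfl

/-- **Initial value**: `u_{t₀} = ũ` (item (5): `ν_{x;t₀} = δ_x` for `x ∈ 𝒳_{t₀}`).
[cite: Bamler2023, §3.2, Proposition (existence and uniqueness of heat flows)] -/
theorem heatFlowOf_self (t₀ : I) (u₀ : 𝒳.Slice t₀ → ℝ) : 𝒳.heatFlowOf t₀ u₀ t₀ = u₀ := by
  funext x
  rw [heatFlowOf_apply, 𝒳.condKernel_self, integral_dirac]

/-- The heat flow of a bounded measurable datum is measurable on every later time-slice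
(`y ↦ ∫ ũ dν_{y;t₀}` is an integral against a Markov kernel). [cite: Bamler2023, §3.2, Proposition (existence and uniqueness of heat flows)] -/
theorem measurable_heatFlowOf {t₀ t : I} (h : (t₀ : ℝ) ≤ t) {u₀ : 𝒳.Slice t₀ → ℝ}
    (hu₀ : Measurable u₀) : Measurable (𝒳.heatFlowOf t₀ u₀ t) := by
  have hsm : StronglyMeasurable fun y : 𝒳.Slice t ↦ ∫ z, u₀ z ∂(𝒳.kernel h y) :=
    hu₀.stronglyMeasurable.integral_kernel
  exact hsm.measurable

/-- The heat flow of a datum bounded by `C` is bounded by `C` (a probability average).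
[cite: Bamler2023, §3.2, Proposition (existence and uniqueness of heat flows)] -/
theorem abs_heatFlowOf_le {t₀ t : I} (h : (t₀ : ℝ) ≤ t) {u₀ : 𝒳.Slice t₀ → ℝ} {C : ℝ}
    (hC : ∀ y, |u₀ y| ≤ C) (x : 𝒳.Slice t) : |𝒳.heatFlowOf t₀ u₀ t x| ≤ C := by
  haveI := 𝒳.isProbabilityMeasure_condKernel x h
  rw [heatFlowOf_apply]
  have h1 := norm_integral_le_of_norm_le_const (μ := 𝒳.condKernel x t₀) (f := u₀) (C := C)
    (Eventually.of_forall fun y ↦ by rw [Real.norm_eq_abs]; exact hC y)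
  rw [probReal_univ, mul_one, Real.norm_eq_abs] at h1
  exact h1

/-- **Existence of the heat flow with bounded measurable initial data** (Bamler 2023, §3.2,
Proposition: "Assume that `t₀ := inf I' ∈ I'` and consider a bounded measurable function
`ũ : 𝒳_{t₀} → ℝ`. Then there is a unique heat flow `(u_t)_{t ∈ I'}` with `u_{t₀} = ũ`"; existence
half, with the printed witness `u_t(x) := ∫ ũ dν_{x;t₀}`): for `t₀ ∈ I` with `t₀ ≤ I'` and `ũ`
measurable with `|ũ| ≤ C`, `heatFlowOf t₀ ũ` is a heat flow over `I'` (`IsHeatFlow`): for `s ≤ t` in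
`I'`, `u_s` is bounded measurable hence `ν_{x;s}`-integrable, and
`∫ u_s dν_{x;s} = ∫∫ ũ dν_{y;t₀} dν_{x;s}(y) = ∫ ũ dν_{x;t₀} = u_t(x)` by the reproduction formula.
[cite: Bamler2023, §3.2, Proposition (existence and uniqueness of heat flows)] -/
theorem isHeatFlow_heatFlowOf {I' : Set ℝ} {t₀ : I} (ht₀ : ∀ t ∈ I', (t₀ : ℝ) ≤ t)
    {u₀ : 𝒳.Slice t₀ → ℝ} (hu₀ : Measurable u₀) {C : ℝ} (hC : ∀ y, |u₀ y| ≤ C) :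
    𝒳.IsHeatFlow I' (𝒳.heatFlowOf t₀ u₀) := by
  intro s t hs ht hst x
  have h0s : (t₀ : ℝ) ≤ s := ht₀ s hs
  haveI := 𝒳.isProbabilityMeasure_condKernel x hst
  refine ⟨integrable_of_bounded_measurable (𝒳.measurable_heatFlowOf h0s hu₀)
    (fun y ↦ 𝒳.abs_heatFlowOf_le h0s hC y), ?_⟩
  simp only [heatFlowOf_apply]
  exact (𝒳.integral_integral_condKernel h0s hst x hu₀ hC).symm

/-- **Uniqueness of the heat flow with given initial data** (same Proposition, uniqueness
half): a heat flow over `I'` with `t₀ = min I'` is determined by `u_{t₀}`: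
`u_t(x) = ∫ u_{t₀} dν_{x;t₀}`, i.e. `u = heatFlowOf t₀ (u t₀)` on `I'`.
[cite: Bamler2023, §3.2, Proposition (existence and uniqueness of heat flows)] -/
theorem IsHeatFlow.eq_heatFlowOf {I' : Set ℝ} {u : ∀ t : I, 𝒳.Slice t → ℝ}
    (hu : 𝒳.IsHeatFlow I' u) {t₀ : I} (ht₀I : (t₀ : ℝ) ∈ I') (ht₀ : ∀ t ∈ I', (t₀ : ℝ) ≤ t)
    {t : I} (ht : (t : ℝ) ∈ I') : u t = 𝒳.heatFlowOf t₀ (u t₀) t := by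
  funext x
  exact (hu ht₀I ht (ht₀ t ht) x).2

/-! ### Conjugate heat flows from final data -/

/-- **The conjugate heat flow with final datum `μ̃` at time `t₀`**: `μ_t := ∫_{𝒳_{t₀}} ν_{x;t} dμ̃(x)`
(Bamler 2023, §3.2, proof of the Proposition on existence of conjugate heat flows), i.e. the
composition `ν_{·;t} ∘ₘ μ̃`, for `t ≤ t₀` in `I` (and the junk value `0` for `t > t₀`).
[cite: Bamler2023, §3.2, Proposition (existence and uniqueness of conjugate heat flows)] -/
def conjugateHeatFlowOf (t₀ : I) (μ₀ : Measure (𝒳.Slice t₀)) (t : I) : Measure (𝒳.Slice t) :=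
  if h : (t : ℝ) ≤ t₀ then 𝒳.kernel h ∘ₘ μ₀ else 0

/-- Unfolding for `t ≤ t₀`. [cite: Bamler2023, §3.2, Proposition (existence and uniqueness of conjugate heat flows)] -/
theorem conjugateHeatFlowOf_of_le (t₀ : I) (μ₀ : Measure (𝒳.Slice t₀)) {t : I} (h : (t : ℝ) ≤ t₀) :
    𝒳.conjugateHeatFlowOf t₀ μ₀ t = 𝒳.kernel h ∘ₘ μ₀ := by
  rw [conjugateHeatFlowOf, dif_pos h]

/-- **Final value**: `μ_{t₀} = μ̃` (item (5): the kernel at `t₀` from `𝒳_{t₀}` is the Dirac kernel).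
[cite: Bamler2023, §3.2, Proposition (existence and uniqueness of conjugate heat flows)] -/
theorem conjugateHeatFlowOf_self (t₀ : I) (μ₀ : Measure (𝒳.Slice t₀)) :
    𝒳.conjugateHeatFlowOf t₀ μ₀ t₀ = μ₀ := by
  rw [𝒳.conjugateHeatFlowOf_of_le t₀ μ₀ le_rfl]
  have hk : 𝒳.kernel (le_refl (t₀ : ℝ)) = Kernel.id := by
    ext y : 1
    rw [kernel_apply, 𝒳.condKernel_self, Kernel.id_apply]
  rw [hk, Measure.id_comp]

/-- **Existence of the conjugate heat flow with given final data** (Bamler 2023, §3.2,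
Proposition: "Assume that `t₀ := sup I' ∈ I'` and consider a probability measure
`μ̃ ∈ 𝒫(𝒳_{t₀})`. Then there is a unique conjugate heat flow `(μ_t)_{t ∈ I'}` with `μ_{t₀} = μ̃`";
existence half with the printed witness): for `t₀ ∈ I` with `I' ≤ t₀` and `μ̃` a probability
measure, `conjugateHeatFlowOf t₀ μ̃` is a conjugate heat flow over `I'`: each `μ_t` is a probability
measure and `μ_s(S) = ∫ ν_{x;s}(S) dμ_t(x)` for `s ≤ t` in `I'` (associativity of `∘ₘ` and the
reproduction formula as `ν_{·;s} = ν_{·;s} ∘ₖ ν_{·;t}` on `𝒳_{t₀}`).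
[cite: Bamler2023, §3.2, Proposition (existence and uniqueness of conjugate heat flows)] -/
theorem isConjugateHeatFlow_conjugateHeatFlowOf {I' : Set ℝ} {t₀ : I}
    (ht₀ : ∀ t ∈ I', t ≤ (t₀ : ℝ)) (μ₀ : Measure (𝒳.Slice t₀)) [IsProbabilityMeasure μ₀] :
    𝒳.IsConjugateHeatFlow I' (𝒳.conjugateHeatFlowOf t₀ μ₀) := by
  refine ⟨fun t ht ↦ ?_, ?_⟩
  · rw [𝒳.conjugateHeatFlowOf_of_le t₀ μ₀ (ht₀ t ht)]
    infer_instance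
  · intro s t hs ht hst S hS
    have hs0 : (s : ℝ) ≤ t₀ := ht₀ s hs
    have ht0 : (t : ℝ) ≤ t₀ := ht₀ t ht
    -- `ν_{·;s} = ν_{·;s} ∘ₖ ν_{·;t}` as kernels on `𝒳_{t₀}`
    have hcomp : 𝒳.kernel hs0 = 𝒳.kernel hst ∘ₖ 𝒳.kernel ht0 := by
      ext y : 1
      rw [Kernel.comp_apply, kernel_apply, kernel_apply]
      exact 𝒳.condKernel_eq_comp hst ht0 y
    rw [𝒳.conjugateHeatFlowOf_of_le t₀ μ₀ hs0, 𝒳.conjugateHeatFlowOf_of_le t₀ μ₀ ht0, hcomp,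
      ← Measure.comp_assoc, Measure.bind_apply hS (𝒳.kernel hst).aemeasurable]
    rfl

/-- **Uniqueness of the conjugate heat flow with given final data** (same Proposition,
uniqueness half): a conjugate heat flow over `I'` with `t₀ = max I'` is determined by `μ_{t₀}`:
`μ_t = ν_{·;t} ∘ₘ μ_{t₀} = conjugateHeatFlowOf t₀ (μ t₀) t` for `t ∈ I'`.
[cite: Bamler2023, §3.2, Proposition (existence and uniqueness of conjugate heat flows)] -/
theorem IsConjugateHeatFlow.eq_conjugateHeatFlowOf {I' : Set ℝ} {μ : ∀ t : I, Measure (𝒳.Slice t)}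
    (hμ : 𝒳.IsConjugateHeatFlow I' μ) {t₀ : I} (ht₀I : (t₀ : ℝ) ∈ I') {t : I} (ht : (t : ℝ) ∈ I')
    (htt₀ : (t : ℝ) ≤ t₀) : μ t = 𝒳.conjugateHeatFlowOf t₀ (μ t₀) t := by
  rw [𝒳.conjugateHeatFlowOf_of_le t₀ (μ t₀) htt₀]
  ext S hS
  rw [Measure.bind_apply hS (𝒳.kernel htt₀).aemeasurable]
  exact hμ.2 ht ht₀I htt₀ S hS

/-! ### Basic properties of heat flows (linearity, maximum principle) -/

/-- **Linear combinations of heat flows are heat flows** (Bamler 2023, §3.2, Proposition (basic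
properties of heat flows), (a): "Any linear combination of finitely many heat flows is again a heat
flow"; here for `a u + b v`, which generates all finite combinations).
[cite: Bamler2023, §3.2, Proposition (basic properties of heat flows) (a)] -/
theorem IsHeatFlow.add_smul {I' : Set ℝ} {u v : ∀ t : I, 𝒳.Slice t → ℝ} (hu : 𝒳.IsHeatFlow I' u)
    (hv : 𝒳.IsHeatFlow I' v) (a b : ℝ) :
    𝒳.IsHeatFlow I' (fun t x ↦ a * u t x + b * v t x) := by
  intro s t hs ht hst x
  obtain ⟨hui, hueq⟩ := hu hs ht hst x
  obtain ⟨hvi, hveq⟩ := hv hs ht hst x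
  refine ⟨(hui.const_mul a).add (hvi.const_mul b), ?_⟩
  rw [integral_add (hui.const_mul a) (hvi.const_mul b), integral_const_mul, integral_const_mul,
    ← hueq, ← hveq]

/-- **Maximum principle for heat flows, upper bound** (Bamler 2023, §3.2, Proposition (basic
properties of heat flows), (b): "If `u_s ≤ a` for some `a ∈ ℝ`, then `u_t ≤ a`"; the printed
characterisation of the equality case via `supp ν_{x;s}` is not included): for a heat flow over
`I'` and `s ≤ t` in `I'`, `u_s ≤ a` implies `u_t ≤ a` (`u_t(x)` is a `ν_{x;s}`-average of `u_s`).
[cite: Bamler2023, §3.2, Proposition (basic properties of heat flows) (b)] -/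
theorem IsHeatFlow.le_of_le {I' : Set ℝ} {u : ∀ t : I, 𝒳.Slice t → ℝ} (hu : 𝒳.IsHeatFlow I' u)
    {s t : I} (hs : (s : ℝ) ∈ I') (ht : (t : ℝ) ∈ I') (hst : (s : ℝ) ≤ t) {a : ℝ}
    (ha : ∀ y, u s y ≤ a) (x : 𝒳.Slice t) : u t x ≤ a := by
  haveI := 𝒳.isProbabilityMeasure_condKernel x hst
  obtain ⟨hui, hueq⟩ := hu hs ht hst x
  rw [hueq]
  calc ∫ y, u s y ∂𝒳.condKernel x s ≤ ∫ _, a ∂𝒳.condKernel x s :=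
        integral_mono hui (integrable_const a) ha
    _ = a := by rw [integral_const, probReal_univ, one_smul]

/-- **Maximum principle for heat flows, lower bound** (same Proposition, (c): "If `u_s ≥ a` for
some `a ∈ ℝ`, then `u_t ≥ a`"; equality case not included).
[cite: Bamler2023, §3.2, Proposition (basic properties of heat flows) (c)] -/
theorem IsHeatFlow.ge_of_ge {I' : Set ℝ} {u : ∀ t : I, 𝒳.Slice t → ℝ} (hu : 𝒳.IsHeatFlow I' u)
    {s t : I} (hs : (s : ℝ) ∈ I') (ht : (t : ℝ) ∈ I') (hst : (s : ℝ) ≤ t) {a : ℝ}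
    (ha : ∀ y, a ≤ u s y) (x : 𝒳.Slice t) : a ≤ u t x := by
  haveI := 𝒳.isProbabilityMeasure_condKernel x hst
  obtain ⟨hui, hueq⟩ := hu hs ht hst x
  rw [hueq]
  calc a = ∫ _, a ∂𝒳.condKernel x s := by rw [integral_const, probReal_univ, one_smul]
    _ ≤ ∫ y, u s y ∂𝒳.condKernel x s := integral_mono (integrable_const a) hui ha

/-- **Heat flows pair constantly with conjugate heat flows** (Bamler 2023, §3.2, Proposition
(properties of conjugate heat flows), (c): "`∫_{𝒳_t} u_t dμ_t` is constant in `t ∈ I'`"; here for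
bounded measurable heat flows, where all integrability is automatic): for a heat flow `u` with
`|u_s| ≤ C`, `u_s` measurable, and a conjugate heat flow `μ` over `I'`, `s ≤ t` in `I'`:
`∫ u_s dμ_s = ∫ u_t dμ_t` — by `μ_s = ν_{·;s} ∘ₘ μ_t` and `u_t = ∫ u_s dν_{·;s}`.
[cite: Bamler2023, §3.2, Proposition (properties of conjugate heat flows) (c)] -/
theorem IsHeatFlow.integral_eq_integral_of_isConjugateHeatFlow {I' : Set ℝ}
    {u : ∀ t : I, 𝒳.Slice t → ℝ} (hu : 𝒳.IsHeatFlow I' u)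
    {μ : ∀ t : I, Measure (𝒳.Slice t)} (hμ : 𝒳.IsConjugateHeatFlow I' μ)
    {s t : I} (hs : (s : ℝ) ∈ I') (ht : (t : ℝ) ∈ I') (hst : (s : ℝ) ≤ t)
    (hum : Measurable (u s)) {C : ℝ} (hC : ∀ y, |u s y| ≤ C) :
    ∫ y, u s y ∂(μ s) = ∫ x, u t x ∂(μ t) := by
  haveI := hμ.1 t ht
  haveI := hμ.1 s hs
  -- `μ_s = ν_{·;s} ∘ₘ μ_t`
  have hμs : μ s = 𝒳.kernel hst ∘ₘ μ t := by
    ext S hS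
    rw [Measure.bind_apply hS (𝒳.kernel hst).aemeasurable]
    exact hμ.2 hs ht hst S hS
  have hfi : Integrable (u s) (𝒳.kernel hst ∘ₘ μ t) := by
    rw [← hμs]; exact integrable_of_bounded_measurable hum hC
  rw [hμs, integral_comp_eq_integral_integral hfi]
  refine integral_congr_ae (Eventually.of_forall fun x ↦ ?_)
  exact ((hu hs ht hst x).2).symm

end MetricFlow

end Literature.Geometry.Riemannian

end
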